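import Literature.Computability.Cryptography.PseudoPeriodicCorrMass
import HarnessLib

/-!
# Fourier sampling of a pseudo-periodic table, II: approximate combs

Topic `Computability/Cryptography`; continues `PseudoPeriodicCorrMass.lean` (`IsComb`,
`norm_fibreSum_ge`, `corrMass_ge_of_combs`). Theorem-and-definition file (no named facts).
A finite-precision evaluation of Hallgren's periodic function presents level sets that are combs
only up to a few insertions and deletions (Jozsa 2003, §10: weak periodicity is required "only for
a suitably large fraction `1 − 1/poly` of the values"; the proof of Thm. 6 "omits explicit analysis
of these extra obfuscating variations"). This file supplies that analysis in the elementary form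
needed downstream:

* `norm_sum_sub_sum_le_card` — unit-bounded sums over two sets differ by at most the size of the
  symmetric difference;
* `IsApproxComb Q S F v₀ p m` (a comb of `p` teeth up to `m` modifications), `IsComb.isApproxComb`;
* `norm_sum_teeth_ge` (the bare teeth sum is `≥ p/12`), **`norm_fibreSum_ge_of_isApproxComb`**
  (`≥ p/12 − m`) and **`corrMass_ge_of_approxCombs`** (`corrMass ≥ #G · (p_min/12 − m)²`).

## References

* R. Jozsa, *Notes on Hallgren's efficient quantum algorithm for solving Pell's equation*,
  arXiv:quant-ph/0302134 (2003), §10 (Definition and remark; Thm. 6; Lemma 3). [Jozsa2003]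
-/

noncomputable section

namespace Literature.Computability.Cryptography

namespace PeriodFinding

open Complex Finset Real

variable {Ω : Type*} [DecidableEq Ω]

/-! ### Approximate combs (level sets that are combs up to a few insertions and deletions) -/

/-- Sums of unit-bounded terms over two finite sets differ by at most the size of the symmetric
difference. [folklore] -/
theorem norm_sum_sub_sum_le_card {ι : Type*} [DecidableEq ι] (A B : Finset ι) (f : ι → ℂ)
    (hf : ∀ i, ‖f i‖ ≤ 1) :
    ‖∑ i ∈ A, f i - ∑ i ∈ B, f i‖ ≤ ((A \ B).card : ℝ) + (B \ A).card := by
  have hA : ∑ i ∈ A, f i = ∑ i ∈ A \ B, f i + ∑ i ∈ A ∩ B, f i := by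
    rw [← sum_union (disjoint_sdiff_inter A B), sdiff_union_inter]
  have hB : ∑ i ∈ B, f i = ∑ i ∈ B \ A, f i + ∑ i ∈ A ∩ B, f i := by
    rw [inter_comm, ← sum_union (disjoint_sdiff_inter B A), sdiff_union_inter]
  rw [hA, hB, add_sub_add_right_eq_sub]
  refine (norm_sub_le _ _).trans (add_le_add ?_ ?_)
  · refine (norm_sum_le _ _).trans ?_
    have := sum_le_sum fun i (_ : i ∈ A \ B) => hf i
    rwa [sum_const, nsmul_eq_mul, mul_one] at this
  · refine (norm_sum_le _ _).trans ?_
    have := sum_le_sum fun i (_ : i ∈ B \ A) => hf i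
    rwa [sum_const, nsmul_eq_mul, mul_one] at this

/-- **The level set of `F` through `v₀` is a comb of `p` teeth up to `m` modifications**: there
are distinct teeth `r_0, …, r_{p−1} < Q` with `|r_l − (v₀ + lS)| < 1` whose set differs from the
level set `{v < Q : F v = F v₀}` in at most `m` elements (symmetric difference) — the form in which
a finite-precision evaluation of Hallgren's function presents its level sets.
[cite: Jozsa2003, §10 (remark after the Definition: the condition holds for a fraction 1 − 1/poly of the values)] -/
def IsApproxComb (Q : ℕ) (S : ℝ) (F : ℕ → Ω) (v₀ p m : ℕ) : Prop :=
  ∃ r : ℕ → ℕ, (∀ l < p, |(r l : ℝ) - (v₀ + l * S)| < 1) ∧ (∀ l < p, r l < Q) ∧ Set.InjOn r (Set.Iio p) ∧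
    ((((range Q).filter (fun v => F v = F v₀)) \ (range p).image r).card +
      (((range p).image r) \ ((range Q).filter (fun v => F v = F v₀))).card ≤ m)

omit [DecidableEq Ω] in
/-- An exact comb is an approximate comb with no modification. [folklore] -/
theorem IsComb.isApproxComb {Q : ℕ} {S : ℝ} {F : ℕ → Ω} {v₀ p : ℕ} [DecidableEq Ω]
    (h : IsComb Q S F v₀ p) : IsApproxComb Q S F v₀ p 0 := by
  obtain ⟨r, hr, hinj, hset⟩ := h
  refine ⟨r, hr, fun l hl => ?_, hinj, ?_⟩
  · have : r l ∈ (range p).image r := mem_image_of_mem r (mem_range.mpr hl)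
    rw [← hset] at this
    exact mem_range.mp (mem_filter.mp this).1
  · rw [hset]; simp

/-- **The Fourier coefficient of a bare comb of teeth** (no level-set hypothesis): for distinct
teeth `r_l < Q`, `|r_l − (v₀ + lS)| < 1`, `‖∑_{l<p} e^{2πi c r_l/Q}‖ ≥ p/12` at every `c` within
`1/2` of `kQ/S`, `30k ≤ S`, `Q ≥ max(100, 5S + 5)`. [cite: Jozsa2003, §10 (proof of Thm. 6 with Lemma 3)] -/
theorem norm_sum_teeth_ge {Q : ℕ} {S : ℝ} {v₀ p k : ℕ} {c : ℤ} {r : ℕ → ℕ}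
    (hS : 1 ≤ S) (hQ : (100 : ℝ) ≤ Q) (hQS : 5 * S + 5 ≤ Q)
    (hr : ∀ l < p, |(r l : ℝ) - (v₀ + l * S)| < 1) (hrQ : ∀ l < p, r l < Q)
    (hk : 30 * (k : ℝ) ≤ S) (hc : |(c : ℝ) - k * Q / S| ≤ 1 / 2) :
    (p : ℝ) / 12 ≤ ‖∑ l ∈ range p, chr Q c (r l)‖ := by
  classical
  -- the level sets of the injective-index table `l ↦ l` restricted... we reuse `norm_fibreSum_ge`
  -- through the table `G v = (v ∈ teeth)`-free route: repeat its proof with the teeth only.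
  have hQpos : (0 : ℝ) < Q := by linarith
  have hQ0 : 0 < Q := by exact_mod_cast hQpos
  have hS0 : 0 < S := by linarith
  set ε : ℝ := (c : ℝ) - k * Q / S with hεdef
  have hterm : ∀ l ∈ range p, chr Q c (r l) =
      cexp (2 * π * I * ((c : ℂ) * v₀ / Q)) *
        cexp (2 * π * I * (((ε * S / Q : ℝ) : ℂ) * l +
          ((k * ((r l : ℝ) - (v₀ + l * S)) / S + ε * ((r l : ℝ) - (v₀ + l * S)) / Q : ℝ) : ℂ))) := by
    intro l _
    rw [chr_def]
    have := chr_tooth hQ0 hS0 c k v₀ l (r l) ((r l : ℝ) - (v₀ + l * S)) ε (by ring) (by rw [hεdef]; ring)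
    push_cast at this ⊢
    rw [this]
  have hv₀ : ‖cexp (2 * π * I * ((c : ℂ) * v₀ / Q))‖ = 1 := by
    rw [show (2 * π * I * ((c : ℂ) * v₀ / Q) : ℂ) = 2 * π * I * (((c : ℝ) * v₀ / Q : ℝ) : ℂ) by push_cast; ring]
    exact norm_cexp_two_pi_mul_I _
  rw [sum_congr rfl hterm, ← mul_sum, norm_mul, hv₀, one_mul]
  have hteeth : ∀ l < p, (l : ℝ) * S < Q + 1 := by
    intro l hl
    have h1 := hr l hl
    have h2' : (r l : ℝ) + 1 ≤ Q := by exact_mod_cast hrQ l hl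
    have := (abs_lt.mp h1).1
    have hv : (0 : ℝ) ≤ v₀ := Nat.cast_nonneg _
    linarith
  have hpS : (p : ℝ) * S ≤ Q + 1 + S := by
    rcases Nat.eq_zero_or_pos p with hp | hp
    · subst hp; simp; linarith
    · have := hteeth (p - 1) (Nat.sub_lt hp one_pos)
      rw [Nat.cast_pred hp] at this
      linarith
  have hεb : |ε| ≤ 1 / 2 := hc
  have hpa : (p : ℝ) * |ε * S / Q| ≤ 3 / 5 := by
    rw [abs_div, abs_mul, abs_of_pos hS0, abs_of_pos hQpos]
    calc (p : ℝ) * (|ε| * S / Q) = (p * S) * |ε| / Q := by ring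
      _ ≤ (Q + 1 + S) * (1 / 2) / Q := by
          apply div_le_div_of_nonneg_right _ hQpos.le
          exact mul_le_mul hpS hεb (abs_nonneg _) (by linarith)
      _ ≤ 3 / 5 := by
          rw [div_le_iff₀ hQpos]; linarith
  have hξb : ∀ l < p, |(k * ((r l : ℝ) - (v₀ + l * S)) / S + ε * ((r l : ℝ) - (v₀ + l * S)) / Q)| ≤ 1 / (8 * π) := by
    intro l hl
    set el : ℝ := (r l : ℝ) - (v₀ + l * S) with hel
    have he : |el| ≤ 1 := (hr l hl).le
    have hk0 : (0 : ℝ) ≤ k := Nat.cast_nonneg _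
    have h1 : |(k : ℝ) * el / S| ≤ 1 / 30 := by
      rw [abs_div, abs_mul, abs_of_nonneg hk0, abs_of_pos hS0, div_le_iff₀ hS0]
      nlinarith [abs_nonneg el]
    have h2 : |ε * el / Q| ≤ 1 / 200 := by
      rw [abs_div, abs_mul, abs_of_pos hQpos, div_le_iff₀ hQpos]
      nlinarith [abs_nonneg el, abs_nonneg ε]
    have hπ : 1 / 30 + 1 / 200 ≤ 1 / (8 * π) := by
      rw [le_div_iff₀ (by positivity)]
      have := Real.pi_lt_d2
      nlinarith
    calc |(k : ℝ) * el / S + ε * el / Q| ≤ |(k : ℝ) * el / S| + |ε * el / Q| := abs_add_le _ _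
      _ ≤ 1 / (8 * π) := by linarith
  exact norm_sum_exp_perturb_ge (ξ := fun l => k * ((r l : ℝ) - (v₀ + l * S)) / S + ε * ((r l : ℝ) - (v₀ + l * S)) / Q)
    hpa hξb

/-- **An approximate comb has a large Fourier coefficient**: `‖∑_{v < Q, F v = F v₀} e^{2πi cv/Q}‖
≥ p/12 − m` under the hypotheses of `norm_fibreSum_ge`, when the level set is a comb of `p` teeth
up to `m` modifications. [cite: Jozsa2003, §10 (proof of Thm. 6; remark on the fraction 1 − 1/poly)] -/
theorem norm_fibreSum_ge_of_isApproxComb {Q : ℕ} {S : ℝ} {F : ℕ → Ω} {v₀ p m k : ℕ} {c : ℤ}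
    (hS : 1 ≤ S) (hQ : (100 : ℝ) ≤ Q) (hQS : 5 * S + 5 ≤ Q) (hcomb : IsApproxComb Q S F v₀ p m)
    (hk : 30 * (k : ℝ) ≤ S) (hc : |(c : ℝ) - k * Q / S| ≤ 1 / 2) :
    (p : ℝ) / 12 - m ≤ ‖∑ v ∈ (range Q).filter (fun v => F v = F v₀), chr Q c v‖ := by
  obtain ⟨r, hr, hrQ, hinj, hcard⟩ := hcomb
  have hteeth := norm_sum_teeth_ge hS hQ hQS hr hrQ hk hc
  have hsum : ∑ v ∈ (range p).image r, chr Q c (v : ℤ) = ∑ l ∈ range p, chr Q c ((r l : ℕ) : ℤ) :=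
    sum_image fun x hx y hy h => hinj (mem_coe.mp hx |> mem_range.mp) (mem_coe.mp hy |> mem_range.mp) h
  rw [← hsum] at hteeth
  have hdiff := norm_sum_sub_sum_le_card ((range p).image r) ((range Q).filter (fun v => F v = F v₀))
    (fun v => chr Q c v) (fun v => (norm_chr Q c v).le)
  have hm : (((range p).image r \ (range Q).filter (fun v => F v = F v₀)).card : ℝ) +
      (((range Q).filter (fun v => F v = F v₀)) \ (range p).image r).card ≤ m := by
    rw [add_comm]; exact_mod_cast hcard
  have := norm_sub_norm_le (∑ i ∈ (range p).image r, chr Q c i)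
    (∑ i ∈ (range Q).filter (fun v => F v = F v₀), chr Q c i)
  linarith

/-- **The autocorrelation mass of a table whose good level sets are approximate combs**:
`corrMass Q F c ≥ #G · (p_min/12 − m)²` (with `12m ≤ p_min`) at every `c` within `1/2` of `kQ/S`,
`30k ≤ S`. [cite: Jozsa2003, §10 Thm. 6 (proof) with the remark on weak periodicity up to a fraction 1/poly] -/
theorem corrMass_ge_of_approxCombs {Q : ℕ} {S : ℝ} {F : ℕ → Ω} {k pmin m : ℕ} {c : ℤ} (G : Finset ℕ)
    (hS : 1 ≤ S) (hQ : (100 : ℝ) ≤ Q) (hQS : 5 * S + 5 ≤ Q) (hk : 30 * (k : ℝ) ≤ S)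
    (hc : |(c : ℝ) - k * Q / S| ≤ 1 / 2) (hGQ : ∀ v₀ ∈ G, v₀ < Q) (hinj : Set.InjOn F G)
    (hm : 12 * (m : ℝ) ≤ pmin) (hG : ∀ v₀ ∈ G, ∃ p, pmin ≤ p ∧ IsApproxComb Q S F v₀ p m) :
    (G.card : ℝ) * ((pmin : ℝ) / 12 - m) ^ 2 ≤ corrMass Q F c := by
  unfold corrMass
  have hsub : G.image F ⊆ (range Q).image F :=
    image_subset_image (fun v hv => mem_range.mpr (hGQ v hv))
  refine le_trans ?_ (sum_le_sum_of_subset_of_nonneg hsub fun _ _ _ => by positivity)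
  rw [sum_image fun x hx y hy h => hinj hx hy h]
  have hb : ∀ v₀ ∈ G, ((pmin : ℝ) / 12 - m) ^ 2 ≤
      ‖∑ v ∈ (range Q).filter (fun v => F v = F v₀), chr Q c v‖ ^ 2 := by
    intro v₀ hv₀
    obtain ⟨p, hp, hcomb⟩ := hG v₀ hv₀
    have h1 := norm_fibreSum_ge_of_isApproxComb hS hQ hQS hcomb hk hc
    have h0 : (0 : ℝ) ≤ (pmin : ℝ) / 12 - m := by linarith
    have hp' : (pmin : ℝ) / 12 - m ≤ p / 12 - m := by
      have : (pmin : ℝ) ≤ p := by exact_mod_cast hp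
      linarith
    exact pow_le_pow_left₀ h0 (hp'.trans h1) 2
  refine le_trans ?_ (sum_le_sum hb)
  rw [sum_const, nsmul_eq_mul]

end PeriodFinding

end Literature.Computability.Cryptography

end
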